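import Literature.Computability.Complexity.MonotoneClosure

/-!
# Route NegLimited — the CKR closure operator for an arbitrary negative input distribution (rung F-N1/p3, line r7-crosscut, file C1)

Cavalar–Kumar–Rossman's closure formalism (Algorithmica 84 (2022), §2.4–2.5; the tree's
`Literature/Computability/Complexity/MonotoneClosure.lean`, namespace `CKR`, for the UNIFORM input
`prHalf`) with the uniform negative test input replaced by an ARBITRARY weight `μ : 𝒫(V) → ℝ≥0`
of total mass `1` on the supports (`prW μ E = Σ_{U : E U} μ U`). Everything in CKR §2.4–2.5 is a
union bound over the additions of the closure process, so the proofs are those of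
`MonotoneClosure.lean` with `prHalf ↦ prW μ`; the measure-free parts (`Razborov.minimals`, `CKR.trim`,
`CKR.containing`) are imported, not copied. Cell record: HOME/pnp-ideate-p3/ROUND-7.md §4 (engine
design, row C1) — first piece of the registered stub `stub_gapPMExp` of item stmt-PneNP-19861.

* `prW μ E` and its calculus (`prW_nonneg`, `prW_mono`, `prW_le_add`, `prW_not`, `prW_eq_zero`);
* `IsClosedFamW μ c ε 𝒯` — CKR Def. 2.6 w.r.t. `μ`; `closureW μ c ε 𝒮` — CKR Def. 2.8;
* `prW_not_mem_and_mem_closureW_le` — CKR Lemma 2.10: `Pr_μ[U ∉ 𝒮 ∧ U ∈ cl(𝒮)] ≤ ε·#{A : |A| ≤ c}`;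
* `isClosedFamW_containing` — CKR Lemma 2.12 under the hypothesis `Pr_μ[i ∈ U] ≤ 1 - ε`;
* `exists_minimal_of_mem_of_not_mem_trim_closureW` — the containment behind CKR Lemma 2.16.
-/

set_option linter.dupNamespace false -- `Summit.PneNP.PneNP.…`: summit = sub-problem name (D-0017 single-conjunct layout)

namespace Summit.PneNP.PneNP.Theorems.NegLimitedGapPM

open Finset Literature.Computability.Complexity.Razborov Literature.Computability.Complexity.CKR

variable {V : Type*} [Fintype V] [DecidableEq V]

/-! ### An arbitrary negative input distribution on the supports -/

/-- `Pr_μ[E(U)]` for a random support `U ⊆ V` with weights `μ` (CKR's `𝐍` of Def. 2.2 is the case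
`μ ≡ 2^{-|V|}`, `CKR.prHalf`). -/
def prW (μ : Finset V → ℝ) (E : Finset V → Prop) [DecidablePred E] : ℝ := ∑ U ∈ univ.filter E, μ U

variable {μ : Finset V → ℝ}

omit [DecidableEq V] in
/-- Probabilities are nonnegative (for nonnegative weights). -/
theorem prW_nonneg (hμ : ∀ U, 0 ≤ μ U) (E : Finset V → Prop) [DecidablePred E] : 0 ≤ prW μ E :=
  sum_nonneg fun U _ => hμ U

omit [DecidableEq V] in
/-- Monotonicity of probability. -/
theorem prW_mono (hμ : ∀ U, 0 ≤ μ U) {E E' : Finset V → Prop} [DecidablePred E] [DecidablePred E']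
    (h : ∀ U, E U → E' U) : prW μ E ≤ prW μ E' :=
  sum_le_sum_of_subset_of_nonneg (monotone_filter_right _ fun U _ hU => h U hU) fun U _ _ => hμ U

/-- The union bound for two events. -/
theorem prW_le_add (hμ : ∀ U, 0 ≤ μ U) {E E₁ E₂ : Finset V → Prop} [DecidablePred E]
    [DecidablePred E₁] [DecidablePred E₂] (h : ∀ U, E U → E₁ U ∨ E₂ U) :
    prW μ E ≤ prW μ E₁ + prW μ E₂ := by
  unfold prW
  have hsub : univ.filter E ⊆ univ.filter E₁ ∪ univ.filter E₂ := by
    intro U hU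
    rw [mem_union, mem_filter, mem_filter]
    rcases h U (mem_filter.1 hU).2 with h' | h'
    · exact Or.inl ⟨mem_univ _, h'⟩
    · exact Or.inr ⟨mem_univ _, h'⟩
  refine (sum_le_sum_of_subset_of_nonneg hsub fun U _ _ => hμ U).trans ?_
  rw [← sum_union_inter]
  have : 0 ≤ ∑ U ∈ univ.filter E₁ ∩ univ.filter E₂, μ U := sum_nonneg fun U _ => hμ U
  linarith

omit [DecidableEq V] in
/-- Complements: `Pr[¬ E] = 1 - Pr[E]` for weights of total mass `1`. -/
theorem prW_not (hμ1 : ∑ U, μ U = 1) (E : Finset V → Prop) [DecidablePred E] :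
    prW μ (fun U => ¬ E U) = 1 - prW μ E := by
  unfold prW
  rw [← hμ1, ← sum_filter_add_sum_filter_not univ E]
  ring

omit [DecidableEq V] in
/-- An event that never happens has probability `0`. -/
theorem prW_eq_zero {E : Finset V → Prop} [DecidablePred E] (h : ∀ U, ¬ E U) : prW μ E = 0 := by
  unfold prW
  rw [filter_eq_empty_iff.2 fun U _ => h U, sum_empty]

omit [DecidableEq V] in
/-- Events with the same extension have the same probability. -/
theorem prW_congr {E E' : Finset V → Prop} [DecidablePred E] [DecidablePred E']
    (h : ∀ U, E U ↔ E' U) : prW μ E = prW μ E' := by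
  unfold prW
  rw [filter_congr fun U _ => h U]

/-! ### Closed families and the closure operator w.r.t. `μ` -/

/-- **Closed up-sets w.r.t. `μ`** (CKR Def. 2.6 with `𝐍 ∼ μ`): for every `A` with `|A| ≤ c`,
`Pr_μ[A ∪ U ∈ 𝒯] > 1 - ε` forces `A ∈ 𝒯`. -/
def IsClosedFamW (μ : Finset V → ℝ) (c : ℕ) (ε : ℝ) (𝒯 : Finset (Finset V)) : Prop :=
  ∀ A : Finset V, #A ≤ c → 1 - ε < prW μ (fun U => A ∪ U ∈ 𝒯) → A ∈ 𝒯

open Classical in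
/-- **The closure operator w.r.t. `μ`** (CKR Def. 2.8): the least `μ`-closed up-set containing `𝒮`,
as the intersection of all of them. -/
noncomputable def closureW (μ : Finset V → ℝ) (c : ℕ) (ε : ℝ) (𝒮 : Finset (Finset V)) :
    Finset (Finset V) :=
  univ.filter fun A => ∀ 𝒯 : Finset (Finset V), 𝒮 ⊆ 𝒯 → IsUpperSet (𝒯 : Set (Finset V)) →
    IsClosedFamW μ c ε 𝒯 → A ∈ 𝒯

variable {c : ℕ} {ε : ℝ}

/-- Membership in the closure. -/
theorem mem_closureW {𝒮 : Finset (Finset V)} {A : Finset V} :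
    A ∈ closureW μ c ε 𝒮 ↔ ∀ 𝒯 : Finset (Finset V), 𝒮 ⊆ 𝒯 → IsUpperSet (𝒯 : Set (Finset V)) →
      IsClosedFamW μ c ε 𝒯 → A ∈ 𝒯 := by
  classical
  simp [closureW]

/-- `𝒮 ⊆ cl(𝒮)`. -/
theorem subset_closureW (𝒮 : Finset (Finset V)) : 𝒮 ⊆ closureW μ c ε 𝒮 :=
  fun _ hA => mem_closureW.2 fun _ h𝒮 _ _ => h𝒮 hA

/-- The closure is an up-set. -/
theorem isUpperSet_closureW (𝒮 : Finset (Finset V)) :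
    IsUpperSet (closureW μ c ε 𝒮 : Set (Finset V)) := by
  intro A B hAB hA
  rw [mem_coe, mem_closureW] at hA ⊢
  exact fun 𝒯 h1 h2 h3 => h2 hAB (hA 𝒯 h1 h2 h3)

/-- The closure is contained in every closed up-set containing `𝒮` (minimality). -/
theorem closureW_subset {𝒮 𝒯 : Finset (Finset V)} (h1 : 𝒮 ⊆ 𝒯)
    (h2 : IsUpperSet (𝒯 : Set (Finset V))) (h3 : IsClosedFamW μ c ε 𝒯) : closureW μ c ε 𝒮 ⊆ 𝒯 :=
  fun _ hA => mem_closureW.1 hA 𝒯 h1 h2 h3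

/-- The closure is closed (intersections of closed up-sets are closed; CKR Rem. 2.9). -/
theorem isClosedFamW_closureW (hμ : ∀ U, 0 ≤ μ U) (𝒮 : Finset (Finset V)) :
    IsClosedFamW μ c ε (closureW μ c ε 𝒮) := by
  intro A hA hpr
  refine mem_closureW.2 fun 𝒯 h1 h2 h3 => h3 A hA (hpr.trans_le ?_)
  exact prW_mono hμ fun U hU => closureW_subset h1 h2 h3 hU

/-- **CKR Lemma 2.10 w.r.t. `μ`, inductive form**: for an up-set `𝒯` between `𝒮` and its closure,
`Pr_μ[U ∉ 𝒯 ∧ U ∈ cl(𝒮)] ≤ ε · #{A : |A| ≤ c, A ∉ 𝒯}` — add a violating `A` at cost `< ε` and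
recurse (the measure enters only through monotonicity, the union bound and complements). -/
theorem prW_not_mem_and_mem_closureW_le_aux (hμ : ∀ U, 0 ≤ μ U) (hμ1 : ∑ U, μ U = 1)
    (hε : 0 ≤ ε) (𝒮 : Finset (Finset V)) :
    ∀ (n : ℕ) (𝒯 : Finset (Finset V)), IsUpperSet (𝒯 : Set (Finset V)) → 𝒮 ⊆ 𝒯 →
      𝒯 ⊆ closureW μ c ε 𝒮 → #(smallOut c 𝒯) ≤ n →
      prW μ (fun U => U ∉ 𝒯 ∧ U ∈ closureW μ c ε 𝒮) ≤ ε * #(smallOut c 𝒯) := by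
  intro n
  induction n with
  | zero =>
    intro 𝒯 hup h𝒮 hcl hn
    have hclosed : IsClosedFamW μ c ε 𝒯 := by
      intro A hA _
      by_contra hAT
      have : A ∈ smallOut c 𝒯 := mem_filter.2 ⟨mem_filter.2 ⟨mem_univ _, hA⟩, hAT⟩
      rw [Nat.le_zero, card_eq_zero] at hn
      rw [hn] at this
      exact absurd this (notMem_empty A)
    rw [prW_eq_zero fun U ⟨h1, h2⟩ => h1 (closureW_subset h𝒮 hup hclosed h2)]
    positivity
  | succ n ih =>
    intro 𝒯 hup h𝒮 hcl hn
    by_cases hclosed : IsClosedFamW μ c ε 𝒯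
    · rw [prW_eq_zero fun U ⟨h1, h2⟩ => h1 (closureW_subset h𝒮 hup hclosed h2)]
      positivity
    simp only [IsClosedFamW, not_forall, exists_prop] at hclosed
    obtain ⟨A, hAc, hApr, hAT⟩ := hclosed
    set 𝒯' : Finset (Finset V) := 𝒯 ∪ univ.filter fun B => A ⊆ B with h𝒯'
    have hup' : IsUpperSet (𝒯' : Set (Finset V)) := by
      intro B B' hBB' hB
      rw [mem_coe, h𝒯', mem_union] at hB ⊢
      rcases hB with hB | hB
      · exact Or.inl (hup hBB' hB)
      · exact Or.inr (mem_filter.2 ⟨mem_univ _, (mem_filter.1 hB).2.trans hBB'⟩)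
    have h𝒮' : 𝒮 ⊆ 𝒯' := h𝒮.trans subset_union_left
    have hAcl : A ∈ closureW μ c ε 𝒮 :=
      isClosedFamW_closureW hμ 𝒮 A hAc (hApr.trans_le (prW_mono hμ fun U hU => hcl hU))
    have hcl' : 𝒯' ⊆ closureW μ c ε 𝒮 := by
      refine union_subset hcl fun B hB => ?_
      exact isUpperSet_closureW 𝒮 (mem_filter.1 hB).2 hAcl
    have hsub : smallOut c 𝒯' ⊆ smallOut c 𝒯 := by
      intro B hB
      obtain ⟨hB1, hB2⟩ := mem_filter.1 hB
      exact mem_filter.2 ⟨hB1, fun h => hB2 (mem_union_left _ h)⟩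
    have hAin : A ∈ smallOut c 𝒯 := mem_filter.2 ⟨mem_filter.2 ⟨mem_univ _, hAc⟩, hAT⟩
    have hAout : A ∉ smallOut c 𝒯' := fun h =>
      (mem_filter.1 h).2 (mem_union_right _ (mem_filter.2 ⟨mem_univ _, Subset.refl A⟩))
    have hcard : #(smallOut c 𝒯') + 1 ≤ #(smallOut c 𝒯) := by
      have : smallOut c 𝒯' ⊂ smallOut c 𝒯 :=
        Finset.ssubset_iff_subset_ne.2 ⟨hsub, fun h => hAout (h ▸ hAin)⟩
      exact card_lt_card this
    have hIH := ih 𝒯' hup' h𝒮' hcl' (by omega)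
    have herr : prW μ (fun U => U ∈ 𝒯' ∧ U ∉ 𝒯) ≤ ε := by
      have h1 : prW μ (fun U => U ∈ 𝒯' ∧ U ∉ 𝒯) ≤ prW μ (fun U => ¬ (A ∪ U ∈ 𝒯)) := by
        refine prW_mono hμ fun U ⟨hU1, hU2⟩ => ?_
        rw [h𝒯', mem_union] at hU1
        rcases hU1 with hU1 | hU1
        · exact absurd hU1 hU2
        · rwa [union_eq_right.2 (mem_filter.1 hU1).2]
      rw [prW_not hμ1] at h1
      linarith
    calc prW μ (fun U => U ∉ 𝒯 ∧ U ∈ closureW μ c ε 𝒮)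
        ≤ prW μ (fun U => U ∉ 𝒯' ∧ U ∈ closureW μ c ε 𝒮) + prW μ (fun U => U ∈ 𝒯' ∧ U ∉ 𝒯) := by
          refine prW_le_add hμ fun U ⟨hU1, hU2⟩ => ?_
          by_cases hU : U ∈ 𝒯'
          · exact Or.inr ⟨hU, hU1⟩
          · exact Or.inl ⟨hU, hU2⟩
      _ ≤ ε * #(smallOut c 𝒯') + ε := add_le_add hIH herr
      _ ≤ ε * #(smallOut c 𝒯) := by
          have : (#(smallOut c 𝒯') : ℝ) + 1 ≤ #(smallOut c 𝒯) := by exact_mod_cast hcard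
          nlinarith

/-- **CKR Lemma 2.10 w.r.t. `μ`** (approximation by closure): for an up-set `𝒮` and weights `μ ≥ 0`
of total mass `1`, `Pr_μ[U ∉ 𝒮 ∧ U ∈ cl(𝒮)] ≤ ε · #{A ⊆ V : |A| ≤ c}`. -/
theorem prW_not_mem_and_mem_closureW_le (hμ : ∀ U, 0 ≤ μ U) (hμ1 : ∑ U, μ U = 1) (hε : 0 ≤ ε)
    (𝒮 : Finset (Finset V)) (h𝒮 : IsUpperSet (𝒮 : Set (Finset V))) :
    prW μ (fun U => U ∉ 𝒮 ∧ U ∈ closureW μ c ε 𝒮)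
      ≤ ε * #(univ.filter fun A : Finset V => #A ≤ c) := by
  have h := prW_not_mem_and_mem_closureW_le_aux (c := c) hμ hμ1 hε 𝒮 _ 𝒮 h𝒮 Subset.rfl
    (subset_closureW 𝒮) le_rfl
  refine h.trans (mul_le_mul_of_nonneg_left ?_ hε)
  exact_mod_cast card_le_card (filter_subset _ _)

/-! ### Input functions -/

/-- **CKR Lemma 2.12 w.r.t. `μ`** (input functions are closed): if `Pr_μ[i ∈ U] ≤ 1 - ε` then the
up-set `containing i` of the input `x_i` is `μ`-closed. -/
theorem isClosedFamW_containing (c : ℕ) {i : V}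
    (hinp : prW μ (fun U : Finset V => i ∈ U) ≤ 1 - ε) : IsClosedFamW μ c ε (containing i) := by
  intro A _ hpr
  by_contra hA
  rw [mem_containing] at hA
  have : prW μ (fun U : Finset V => A ∪ U ∈ containing i) = prW μ (fun U : Finset V => i ∈ U) :=
    prW_congr fun U => by simp [hA]
  rw [this] at hpr
  linarith

/-! ### Trimming against the `μ`-closure -/

/-- **Containment behind CKR Lemmas 2.16/2.18, w.r.t. `μ`**: if the up-set `ℋ` has all minterms of
size `≤ c` and `h = cl_μ(ℋ)`, an input accepted by `ℋ` but rejected by `trim(h)` contains a minterm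
of `h` of size in `(c/2, c]`. -/
theorem exists_minimal_of_mem_of_not_mem_trim_closureW {ℋ : Finset (Finset V)}
    (hℋ : ∀ A ∈ minimals ℋ, #A ≤ c) {U : Finset V} (hU : U ∈ ℋ)
    (hUt : U ∉ trim c (closureW μ c ε ℋ)) :
    ∃ A ∈ minimals (closureW μ c ε ℋ), c / 2 < #A ∧ #A ≤ c ∧ A ⊆ U := by
  obtain ⟨A', hA', hA'U⟩ := exists_minimal_subset hU
  obtain ⟨A, hA, hAA'⟩ := exists_minimal_subset (subset_closureW (μ := μ) (c := c) (ε := ε) ℋ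
    (minimals_subset _ hA'))
  have hAc : #A ≤ c := (card_le_card hAA').trans (hℋ A' hA')
  refine ⟨A, hA, ?_, hAc, hAA'.trans hA'U⟩
  by_contra hlt
  exact hUt (mem_trim.2 ⟨A, hA, not_lt.1 hlt, hAA'.trans hA'U⟩)

/-! ### The approximators: trimmed `μ`-closed up-sets (CKR §2.6 w.r.t. `μ`) -/

/-- **The approximators w.r.t. `μ`**: `𝒜 = {trim(𝒯) : 𝒯 a μ-closed up-set}`. -/
def IsApproxW (μ : Finset V → ℝ) (c : ℕ) (ε : ℝ) (𝒜 : Finset (Finset V)) : Prop :=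
  ∃ 𝒯 : Finset (Finset V), IsUpperSet (𝒯 : Set (Finset V)) ∧ IsClosedFamW μ c ε 𝒯 ∧ 𝒜 = trim c 𝒯

/-- Approximators are up-sets. -/
theorem IsApproxW.isUpperSet {𝒜 : Finset (Finset V)} (h : IsApproxW μ c ε 𝒜) :
    IsUpperSet (𝒜 : Set (Finset V)) := by
  obtain ⟨𝒯, -, -, rfl⟩ := h
  exact isUpperSet_trim c 𝒯

/-- Approximators are trimmed: their minterms have size `≤ c/2`. -/
theorem IsApproxW.card_le_of_mem_minimals {𝒜 : Finset (Finset V)} (h : IsApproxW μ c ε 𝒜)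
    {A : Finset V} (hA : A ∈ minimals 𝒜) : #A ≤ c / 2 := by
  obtain ⟨𝒯, -, -, rfl⟩ := h
  exact (minimals_trim hA).2

/-- `trim(cl_μ(𝒮))` is an approximator. -/
theorem isApproxW_trim_closureW (hμ : ∀ U, 0 ≤ μ U) (𝒮 : Finset (Finset V)) :
    IsApproxW μ c ε (trim c (closureW μ c ε 𝒮)) :=
  ⟨closureW μ c ε 𝒮, isUpperSet_closureW 𝒮, isClosedFamW_closureW hμ 𝒮, rfl⟩

/-- The minterms of `𝒜 ∨ ℬ` and of `𝒜 ∧ ℬ` of two approximators have size `≤ c`. -/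
theorem IsApproxW.card_le_of_mem_minimals_union_inter {𝒜 ℬ : Finset (Finset V)}
    (h𝒜 : IsApproxW μ c ε 𝒜) (hℬ : IsApproxW μ c ε ℬ) :
    (∀ A ∈ minimals (𝒜 ∪ ℬ), #A ≤ c) ∧ (∀ A ∈ minimals (𝒜 ∩ ℬ), #A ≤ c) := by
  constructor
  · intro A hA
    rcases minimals_union hA with h | h
    · exact (h𝒜.card_le_of_mem_minimals h).trans (Nat.div_le_self c 2)
    · exact (hℬ.card_le_of_mem_minimals h).trans (Nat.div_le_self c 2)
  · intro A hA
    obtain ⟨M₁, hM₁, M₂, hM₂, rfl⟩ := minimals_inter h𝒜.isUpperSet hℬ.isUpperSet hA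
    have h1 := h𝒜.card_le_of_mem_minimals hM₁
    have h2 := hℬ.card_le_of_mem_minimals hM₂
    calc #(M₁ ∪ M₂) ≤ #M₁ + #M₂ := card_union_le _ _
      _ ≤ c / 2 + c / 2 := Nat.add_le_add h1 h2
      _ ≤ c := by omega

end Summit.PneNP.PneNP.Theorems.NegLimitedGapPM
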